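/-
Copyright: statement-level skeleton of a published paper (lit-balaban cell, Phase-2 proof seat p39 gen 9). No proof claims
beyond what the kernel checks below.
-/
import Literature.MathematicalPhysics.QuantumFieldTheory.Balaban1983to89.B3GkZeroLattice
import Literature.MathematicalPhysics.QuantumFieldTheory.Balaban1983to89.B3GkZeroBoxPointwise

/-!
# B3 — T. Bałaban, *(Higgs)₂,₃ quantum fields in a finite volume. III. Renormalization*, CMP **88** (1983) 411–445
[Balaban1983Higgs3], p. 437 [PDF 27]: the printed kernel inequality **|G^ξ_{j″}(0; y, y′)| ≦ O(1)e^{−δ₀|y−y′|}/|y − y′|** *"and the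
corresponding inequalities for derivatives"* — PROVED AT ALL SITES, INCLUDING THE MIXED SECOND DIFFERENCE, FOR THE PRINTED
INFINITE-LATTICE ZERO-FIELD PROPAGATOR `G_k(0)` on `ηℤ^{d+1}` of p. 433 (*"we substitute G_k(□,0) = G_k(0) + δG_k(□,ηZ^d,0)"*,
p03 gen 8's `B3GkZeroLattice.GkLat`), in the regularised-distance profile shape
`(η·max(1,|x−x′|_∞))^{−p}·e^{−δη|x−x′|_∞}`, `p = d−1, d, d+1`, uniformly in the scale `k ≥ 1` (`η = L^{−k}`) and the window

statement-level skeleton of published theorems with citation tags; proofs where landed; nothing here is a claim about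
the Yang–Mills mass gap

PDF held: `paper:balaban1983-higgs-2-3-quantum-fields-finite-volume` (journal page = PDF page + 410); p. 433 [PDF 23] and p. 437
[PDF 27] read on the ×2 renders `run/shared/lean/pub/pub-balaban/b2b-balaban-ref1/pages/1983-cmp88-higgs23-III/
1983-cmp88-higgs23-III-p023-x2.png`, `…-p027-x2.png`.  Rows **B3.Eq3.11-3.17** (the p. 437 sentence *"Using the inequalities
|C^ξ(y − y′)| ≦ O(1)e^{−½|y−y′|}/|y − y′|, |G^ξ_{j″}(0; y, y′)| ≦ O(1)e^{−δ₀|y−y′|}/|y − y′|, and the corresponding inequalities for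
derivatives, we can estimate (3.16) by a constant"*) and **B3.Eq2.10** ((2.10): *"each differentiation or difference … gives an
additional factor (L^jη)^{−1}"*) of `HOME/lit-balaban-r15/ROWS-B3.md` (fold owner r15); file 1 of the p39 gen-9 programme «the
§3 vector self-energy sentences on the PRINTED infinite lattice ξℤ³» (gens 5–8 of this seat proved them for the TORUS propagator
`G_k(T,0)`; p03 gen 8 has since constructed the lattice propagator the p. 433 sentence names).
WHAT IS REPRODUCED (counting normalisation of the zero-field box lineage: `n = L^k = η^{−1}` fine points per unit block, physical
kernels `= η^{−(d+1)}·(matrix units)`; `L = ℓ + 1 ≥ 2`; sup norm `B4ContourShift.supNorm`; window `[a₋,a₊] × [0,m²₊]`;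
constants existential, functions of `d`, `L`, the window):
* §1 BOX LEVEL, ALL SITES, UNIFORM IN THE BOX `□ = Π_μ[0,M_μ)` of unit blocks (Neumann conditions, p03 g4's `B3Ineq210ZeroBox`
  pieces): `abs_Gfine_profile` (value, `d + 1 ≥ 3`): `n^{d+1}|G_k(□,0;x,x′)| ≤ C·(max(1,|x−x′|_∞)/n)^{−(d−1)}·e^{−δ|x−x′|_∞/n}`
  — gen-5 `abs_Gk_le` off the diagonal and `abs_Gk_diag_le` on it, now ONE all-sites statement; `abs_GfineDiff_profile`
  (row difference, incl. coincident points): `n^{d+1}·n·|G(x+e_μ,x′) − G(x,x′)| ≤ C·(max(1,|x−x′|_∞)/n)^{−d}·e^{−δ|x−x′|_∞/n}`;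
  **`abs_GfineMixed_profile`** (MIXED second difference, all sites — new): `n^{d+1}·n²·|G(x+e_μ,x′+e_ν) − G(x,x′+e_ν) −
  G(x+e_μ,x′) + G(x,x′)| ≤ C·(max(1,|x−x′|_∞)/n)^{−(d+1)}·e^{−δ|x−x′|_∞/n}`, from p03 g5's per-piece mixed clause
  `B3GkZeroBoxSeparated.abs_pieceMixed_le` summed over the scales by gen-5's `scaleSum_le`/`scaleSum_zero_le` with `p = d + 1`.
* §2 THE INFINITE LATTICE: the same three clauses for `G_k(0) = GkLat` at ALL pairs of points of `ℤ^{d+1}` (`abs_GkLat_profile`,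
  `abs_GkLatDiff_profile`, `abs_GkLatDiff'_profile` (column difference, by `GkLat_comm`), **`abs_GkLatMixed_profile`**), by
  p03's `tendsto_gcube` (the box bounds hold on every centred cube `C_t` containing the points, uniformly in `t`, hence in
  the limit); and the physical-units corollary `abs_GkLat_profile_eta` etc. are left to the consumer (`B3Eq316ResolventZeroLattice`).
HONEST SCOPE: zero external field only (`A = B̃ = 0`, `U ≡ 1`; the printed case after the p. 433 gauge step), unit blocks,
`d + 1 ≥ 3` (the diagonal of a two-dimensional propagator is not bounded by this law), sup norm in lattice units, forward
differences along the coordinate axes; constants existential.  p03's SEPARATED clauses (`B3GkZeroLatticeSeparated`: no singular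
prefactor beyond distance `ρ`) are the far-field companions; this file adds the near-diagonal laws the §3 lattice sums need.
Mathlib + the cited tree files only; theorems only, no definitions, no named facts; standard axioms.  Unit `lit-balaban-p39-g9`
(Phase-2 proof seat p39, gen 9), HOME `run/shared/lean/pub/lit-balaban/`, 2026-08-22.
-/

open scoped BigOperators
open Finset Filter Topology

namespace Literature.MathematicalPhysics.QuantumFieldTheory.Balaban1983to89.B3GkZeroLatticePointwise

open B4ContourShift (supNorm supNorm_nonneg abs_le_supNorm exists_supNorm_eq)
open B4Reflection242 B4BoxCov237 B4TwoBox120 B4Thm110ZeroBox B4Thm110ZeroBoxDeriv B3Ineq210ZeroBox B3GkZeroBoxSeparated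
  B3GkZeroBoxPointwise B3GkZeroLattice

noncomputable section

variable {d : ℕ}

/-! ## §0 Small kernels -/

/-- kernel: `max(1,|u|_∞) = |u|_∞` for `u ≠ 0` (a nonzero integer vector has sup norm `≥ 1`). [cite: Balaban1983Higgs3, (3.16) p.437] -/
theorem max_one_supNorm_of_ne {x x' : Fin (d + 1) → ℤ} (h : x ≠ x') : max 1 (supNorm (x - x')) = supNorm (x - x') := by
  apply max_eq_right
  have hne : x - x' ≠ 0 := sub_ne_zero.2 h
  obtain ⟨i, hi⟩ : ∃ i, (x - x') i ≠ (0 : Fin (d + 1) → ℤ) i := Function.ne_iff.1 hne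
  have h1 : (1 : ℤ) ≤ |(x - x') i| := Int.one_le_abs hi
  have h2 : ((|(x - x') i| : ℤ) : ℝ) ≤ supNorm (x - x') := abs_le_supNorm _ i
  have h3 : (1 : ℝ) ≤ ((|(x - x') i| : ℤ) : ℝ) := by exact_mod_cast h1
  linarith

/-- kernel: `max(1,|0|_∞) = 1`. [cite: Balaban1983Higgs3, (3.16) p.437] -/
theorem max_one_supNorm_self (x : Fin (d + 1) → ℤ) : max 1 (supNorm (x - x)) = 1 := by
  rw [sub_self, supNorm_zero']; exact max_eq_left zero_le_one

/-- kernel: `|x − x|_∞ = 0`. [cite: Balaban1983Higgs3, (3.16) p.437] -/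
theorem supNorm_sub_self (x : Fin (d + 1) → ℤ) : supNorm (x - x) = 0 := by
  rw [sub_self, supNorm_zero']

/-- kernel: the cast `((L^k : ℕ) : ℝ) = (ℓ+1)^k`. [folklore] -/
private theorem cast_Lk (ℓ k : ℕ) : ((((ℓ + 1) ^ k : ℕ)) : ℝ) = ((ℓ : ℝ) + 1) ^ k := by push_cast; ring

/-- kernel: `L^{k-1}·L = L^k` for `k ≥ 1`, as the identity `u/L^{k−1} = L·(u/L^k)`. [folklore] -/
private theorem div_pow_pred_eq {L : ℝ} (hL : 0 < L) {k : ℕ} (hk : 1 ≤ k) (u : ℝ) : u / L ^ (k - 1) = L * (u / L ^ k) := by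
  have hLk : L ^ k = L ^ (k - 1) * L := by rw [← pow_succ, Nat.sub_add_cancel hk]
  rw [hLk]
  field_simp

/-! ## §1 Box level: the zero-field Neumann box propagator at ALL sites, uniformly in the box -/

section Box

variable {ℓ k : ℕ} {M : Fin (d + 1) → ℕ} {a m2 : ℝ}

/-- kernel: `G_k(□,0) = Gfine` is the inverse of the box operator (p03's `sum_piece`/`sum_piece_eq_inv`). [cite: Balaban1983Higgs3, (2.6) p.424] -/
theorem Gfine_eq_inv (hk : 1 ≤ k) :
    Gfine ℓ k M k a m2 = (boxOpR ((ℓ + 1) ^ k) (B1.aSeq a ((ℓ : ℝ) + 1) k) m2 M)⁻¹ :=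
  (sum_piece (ℓ := ℓ) (k := k) (M := M) (a := a) (m2 := m2) hk).symm.trans (sum_piece_eq_inv hk)

/-- **VALUE CLAUSE, ALL SITES** (`d + 1 ≥ 3`): there are `δ, C > 0` such that for every `k ≥ 1`, window point, box and all fine
sites `x, x′` (coincident or not): `n^{d+1}·|G_k(□,0;x,x′)| ≤ C·(max(1,|x−x′|_∞)/n)^{−(d−1)}·e^{−δ|x−x′|_∞/n}`, `n = L^k` — the
printed `O(1)e^{−δ₀|y−y′|}/|y−y′|` (`d + 1 = 3`) with the lattice cut-off of the singularity at the diagonal (gen-5 `abs_Gk_le` +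
`abs_Gk_diag_le`). [cite: Balaban1983Higgs3, (3.16) p.437] -/
theorem abs_Gfine_profile (d ℓ : ℕ) (hd : 2 ≤ d) (hℓ : 1 ≤ ℓ) (amin aplus m2plus : ℝ) (ha : 0 < amin) :
    ∃ δ C : ℝ, 0 < δ ∧ 0 < C ∧ ∀ (k : ℕ), 1 ≤ k → ∀ (a m2 : ℝ), amin ≤ a → a ≤ aplus → 0 ≤ m2 → m2 ≤ m2plus →
      ∀ (M : Fin (d + 1) → ℕ), (∀ i, 1 ≤ M i) → ∀ (x x' : ↥(boxDom (Nf ℓ k M))),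
        (((ℓ : ℝ) + 1) ^ k) ^ (d + 1) * |Gfine ℓ k M k a m2 x x'|
          ≤ C * (max 1 (supNorm (x.1 - x'.1)) / ((ℓ : ℝ) + 1) ^ k)⁻¹ ^ (d - 1) *
              Real.exp (-(δ * (supNorm (x.1 - x'.1) / ((ℓ : ℝ) + 1) ^ k))) := by
  obtain ⟨δ, C, hδ, hC, hG⟩ := abs_Gk_le_eta d ℓ hd hℓ amin aplus m2plus ha
  obtain ⟨C', hC', hD⟩ := eta_pow_mul_Gk_diag_le d ℓ hd hℓ amin aplus m2plus ha
  set L : ℝ := (ℓ : ℝ) + 1 with hLdef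
  have hL : 1 < L := one_lt_L_real hℓ
  have hL0 : 0 < L := by linarith
  have hq : 0 < 1 - (L ^ (d - 1))⁻¹ := by
    have : (L ^ (d - 1))⁻¹ < 1 := inv_lt_one_of_one_lt₀ (one_lt_pow₀ hL (by omega))
    linarith
  refine ⟨δ, C + C' * (1 - (L ^ (d - 1))⁻¹)⁻¹, hδ, by positivity, ?_⟩
  intro k hk a m2 h1 h2 h3 h4 M hM x x'
  rw [Gfine_eq_inv hk]
  have hLk : 0 < L ^ k := pow_pos hL0 k
  by_cases hxx : x.1 = x'.1
  · -- the diagonal: `n^{d+1}|G(x,x)| = n^{d−1}·(n²|G(x,x)|) ≤ n^{d−1}·C'(1−L^{−(d−1)})^{−1}`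
    have hxe : x' = x := Subtype.ext hxx.symm
    rw [hxe, max_one_supNorm_self, supNorm_sub_self, zero_div, mul_zero, neg_zero, Real.exp_zero, mul_one]
    have hDx := hD k hk a m2 h1 h2 h3 h4 M hM x
    have hsplit : (L ^ k) ^ (d + 1) = (L ^ k) ^ (d - 1) * (L ^ k) ^ 2 := by
      rw [← pow_add]; congr 1; omega
    rw [hsplit, mul_assoc, one_div, inv_inv]
    calc (L ^ k) ^ (d - 1) * ((L ^ k) ^ 2 * |(boxOpR ((ℓ + 1) ^ k) (B1.aSeq a L k) m2 M)⁻¹ x x|)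
        ≤ (L ^ k) ^ (d - 1) * (C' * (1 - (L ^ (d - 1))⁻¹)⁻¹) := mul_le_mul_of_nonneg_left hDx (by positivity)
      _ ≤ (C + C' * (1 - (L ^ (d - 1))⁻¹)⁻¹) * (L ^ k) ^ (d - 1) := by
          rw [mul_comm]
          exact mul_le_mul_of_nonneg_right (le_add_of_nonneg_left hC.le) (by positivity)
  · have h := hG k hk a m2 h1 h2 h3 h4 M hM x x' hxx
    rw [max_one_supNorm_of_ne hxx]
    have hP : 0 ≤ (supNorm (x.1 - x'.1) / L ^ k)⁻¹ ^ (d - 1) * Real.exp (-(δ * (supNorm (x.1 - x'.1) / L ^ k))) :=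
      mul_nonneg (pow_nonneg (inv_nonneg.2 (div_nonneg (supNorm_nonneg _) hLk.le)) _) (Real.exp_pos _).le
    calc (L ^ k) ^ (d + 1) * |(boxOpR ((ℓ + 1) ^ k) (B1.aSeq a L k) m2 M)⁻¹ x x'|
        ≤ C * (supNorm (x.1 - x'.1) / L ^ k)⁻¹ ^ (d - 1) * Real.exp (-(δ * (supNorm (x.1 - x'.1) / L ^ k))) := h
      _ ≤ (C + C' * (1 - (L ^ (d - 1))⁻¹)⁻¹) * (supNorm (x.1 - x'.1) / L ^ k)⁻¹ ^ (d - 1) *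
            Real.exp (-(δ * (supNorm (x.1 - x'.1) / L ^ k))) := by
          rw [mul_assoc, mul_assoc]
          exact mul_le_mul_of_nonneg_right (le_add_of_nonneg_right (by positivity)) hP

/-- **DERIVATIVE CLAUSE (ROW), ALL SITES** (`d + 1 ≥ 3`): `n^{d+1}·n·|G_k(□,0;x+e_μ,x′) − G_k(□,0;x,x′)| ≤
C·(max(1,|x−x′|_∞)/n)^{−d}·e^{−δ|x−x′|_∞/n}` for all fine sites `x, x′` with `x + e_μ ∈ □` (gen-5 `abs_GkDiff_le` off the
diagonal; at `x = x′` the two values are bounded separately by the value clause). [cite: Balaban1983Higgs3, (3.16) p.437] -/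
theorem abs_GfineDiff_profile (d ℓ : ℕ) (hd : 2 ≤ d) (hℓ : 1 ≤ ℓ) (amin aplus m2plus : ℝ) (ha : 0 < amin) :
    ∃ δ C : ℝ, 0 < δ ∧ 0 < C ∧ ∀ (k : ℕ), 1 ≤ k → ∀ (a m2 : ℝ), amin ≤ a → a ≤ aplus → 0 ≤ m2 → m2 ≤ m2plus →
      ∀ (M : Fin (d + 1) → ℕ), (∀ i, 1 ≤ M i) →
        ∀ (μ : Fin (d + 1)) (x xe : ↥(boxDom (Nf ℓ k M))), xe.1 = x.1 + Pi.single μ 1 → ∀ (x' : ↥(boxDom (Nf ℓ k M))),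
          (((ℓ : ℝ) + 1) ^ k) ^ (d + 1) * ((((ℓ : ℝ) + 1) ^ k) * |Gfine ℓ k M k a m2 xe x' - Gfine ℓ k M k a m2 x x'|)
            ≤ C * (max 1 (supNorm (x.1 - x'.1)) / ((ℓ : ℝ) + 1) ^ k)⁻¹ ^ d *
                Real.exp (-(δ * (supNorm (x.1 - x'.1) / ((ℓ : ℝ) + 1) ^ k))) := by
  obtain ⟨δ, C, hδ, hC, hG⟩ := abs_GkDiff_le_eta d ℓ (by omega) hℓ amin aplus m2plus ha
  obtain ⟨δ₀, C₀, hδ₀, hC₀, hV⟩ := abs_Gfine_profile d ℓ hd hℓ amin aplus m2plus ha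
  set L : ℝ := (ℓ : ℝ) + 1 with hLdef
  have hL : 1 < L := one_lt_L_real hℓ
  have hL0 : 0 < L := by linarith
  refine ⟨δ, C + 2 * C₀, hδ, by positivity, ?_⟩
  intro k hk a m2 h1 h2 h3 h4 M hM μ x xe hxe x'
  have hLk : 0 < L ^ k := pow_pos hL0 k
  have hLk1 : 1 ≤ L ^ k := one_le_pow₀ hL.le
  by_cases hxx : x.1 = x'.1
  · -- coincident points: `|G(xe,x) − G(x,x)| ≤ |G(xe,x)| + |G(x,x)|`, both `≤ C₀·n^{−(d+1)}·n^{d−1}`-laws at distance `≤ 1`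
    have hxeq : x' = x := Subtype.ext hxx.symm
    rw [hxeq, max_one_supNorm_self, supNorm_sub_self, zero_div, mul_zero, neg_zero, Real.exp_zero, mul_one, one_div, inv_inv]
    have hV1 := hV k hk a m2 h1 h2 h3 h4 M hM xe x
    have hV2 := hV k hk a m2 h1 h2 h3 h4 M hM x x
    rw [max_one_supNorm_self, supNorm_sub_self, zero_div, mul_zero, neg_zero, Real.exp_zero, mul_one, one_div, inv_inv] at hV2
    -- `xe ≠ x`: `max(1,|xe − x|) = 1`
    have hne : xe.1 ≠ x.1 := by
      rw [hxe]; intro h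
      have := congr_fun h μ
      simp at this
    have h1e : supNorm (xe.1 - x.1) = 1 := by
      apply le_antisymm
      · rw [hxe, add_sub_cancel_left]; exact supNorm_single_le μ
      · have := max_one_supNorm_of_ne hne; rw [← this]; exact le_max_left _ _
    rw [max_one_supNorm_of_ne hne, h1e] at hV1
    have hexp : Real.exp (-(δ₀ * (1 / L ^ k))) ≤ 1 := Real.exp_le_one_iff.2 (by
      have : 0 ≤ δ₀ * (1 / L ^ k) := by positivity
      linarith)
    have hpow : (1 / L ^ k)⁻¹ ^ (d - 1) = (L ^ k) ^ (d - 1) := by rw [one_div, inv_inv]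
    have hV1' : (L ^ k) ^ (d + 1) * |Gfine ℓ k M k a m2 xe x| ≤ C₀ * (L ^ k) ^ (d - 1) := by
      calc (L ^ k) ^ (d + 1) * |Gfine ℓ k M k a m2 xe x| ≤ C₀ * (1 / L ^ k)⁻¹ ^ (d - 1) * Real.exp (-(δ₀ * (1 / L ^ k))) := hV1
        _ ≤ C₀ * (1 / L ^ k)⁻¹ ^ (d - 1) * 1 := mul_le_mul_of_nonneg_left hexp (by positivity)
        _ = C₀ * (L ^ k) ^ (d - 1) := by rw [mul_one, hpow]
    have htri : |Gfine ℓ k M k a m2 xe x - Gfine ℓ k M k a m2 x x| ≤ |Gfine ℓ k M k a m2 xe x| + |Gfine ℓ k M k a m2 x x| :=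
      abs_sub _ _
    have hpd : L ^ k * (L ^ k) ^ (d - 1) = (L ^ k) ^ d := by
      rw [mul_comm, ← pow_succ, Nat.sub_add_cancel (by omega : 1 ≤ d)]
    calc (L ^ k) ^ (d + 1) * (L ^ k * |Gfine ℓ k M k a m2 xe x - Gfine ℓ k M k a m2 x x|)
        ≤ (L ^ k) ^ (d + 1) * (L ^ k * (|Gfine ℓ k M k a m2 xe x| + |Gfine ℓ k M k a m2 x x|)) := by gcongr
      _ = L ^ k * ((L ^ k) ^ (d + 1) * |Gfine ℓ k M k a m2 xe x| + (L ^ k) ^ (d + 1) * |Gfine ℓ k M k a m2 x x|) := by ring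
      _ ≤ L ^ k * (C₀ * (L ^ k) ^ (d - 1) + C₀ * (L ^ k) ^ (d - 1)) := by gcongr
      _ = 2 * C₀ * (L ^ k * (L ^ k) ^ (d - 1)) := by ring
      _ = 2 * C₀ * (L ^ k) ^ d := by rw [hpd]
      _ ≤ (C + 2 * C₀) * (L ^ k) ^ d := by gcongr; linarith
  · have h := hG k hk a m2 h1 h2 h3 h4 M hM μ x xe hxe x' hxx
    rw [← Gfine_eq_inv hk] at h
    rw [max_one_supNorm_of_ne hxx]
    have hP : 0 ≤ (supNorm (x.1 - x'.1) / L ^ k)⁻¹ ^ d * Real.exp (-(δ * (supNorm (x.1 - x'.1) / L ^ k))) :=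
      mul_nonneg (pow_nonneg (inv_nonneg.2 (div_nonneg (supNorm_nonneg _) hLk.le)) _) (Real.exp_pos _).le
    calc (L ^ k) ^ (d + 1) * (L ^ k * |Gfine ℓ k M k a m2 xe x' - Gfine ℓ k M k a m2 x x'|)
        ≤ C * (supNorm (x.1 - x'.1) / L ^ k)⁻¹ ^ d * Real.exp (-(δ * (supNorm (x.1 - x'.1) / L ^ k))) := h
      _ ≤ (C + 2 * C₀) * (supNorm (x.1 - x'.1) / L ^ k)⁻¹ ^ d * Real.exp (-(δ * (supNorm (x.1 - x'.1) / L ^ k))) := by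
          rw [mul_assoc, mul_assoc]
          exact mul_le_mul_of_nonneg_right (le_add_of_nonneg_right (by positivity)) hP

/-- kernel: the mixed second difference of `G_k(□,0)` is the sum over the scales of the mixed second differences of its
(2.6) pieces. [cite: Balaban1983Higgs3, (2.6) p.424] -/
theorem Gfine_mixed_eq_sum (hk : 1 ≤ k) (x xe x' xe' : ↥(boxDom (Nf ℓ k M))) :
    (Gfine ℓ k M k a m2 xe xe' - Gfine ℓ k M k a m2 x xe') - (Gfine ℓ k M k a m2 xe x' - Gfine ℓ k M k a m2 x x')
      = ∑ j ∈ range k, ((piece ℓ k M j a m2 xe xe' - piece ℓ k M j a m2 x xe')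
          - (piece ℓ k M j a m2 xe x' - piece ℓ k M j a m2 x x')) := by
  simp only [Gfine_top_apply hk, Finset.sum_sub_distrib]

/-- **MIXED SECOND DIFFERENCE, ALL SITES** — (2.10)'s rule *"each differentiation or difference … gives an additional factor
(L^jη)^{−1}"* applied once in EACH variable and summed over the scales: there are `δ, C > 0` such that for every `k ≥ 1`, window
point, box, axes `μ, ν` and fine sites with `x + e_μ, x′ + e_ν ∈ □` (coincident points included):
`n^{d+1}·n²·|G(x+e_μ,x′+e_ν) − G(x,x′+e_ν) − G(x+e_μ,x′) + G(x,x′)| ≤ C·(max(1,|x−x′|_∞)/n)^{−(d+1)}·e^{−δ|x−x′|_∞/n}`, `G = G_k(□,0)`,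
`n = L^k` — for `d + 1 = 3` the `1/|y−y′|³` law of `(∂_μG∂_ν^*)` (p03 g5's per-piece `abs_pieceMixed_le`, gen-5's `scaleSum_le` with
`p = d + 1`). [cite: Balaban1983Higgs3, (2.10) p.426] -/
theorem abs_GfineMixed_profile (d ℓ : ℕ) (hℓ : 1 ≤ ℓ) (amin aplus m2plus : ℝ) (ha : 0 < amin) :
    ∃ δ C : ℝ, 0 < δ ∧ 0 < C ∧ ∀ (k : ℕ), 1 ≤ k → ∀ (a m2 : ℝ), amin ≤ a → a ≤ aplus → 0 ≤ m2 → m2 ≤ m2plus →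
      ∀ (M : Fin (d + 1) → ℕ), (∀ i, 1 ≤ M i) →
        ∀ (μ ν : Fin (d + 1)) (x xe : ↥(boxDom (Nf ℓ k M))), xe.1 = x.1 + Pi.single μ 1 →
        ∀ (x' xe' : ↥(boxDom (Nf ℓ k M))), xe'.1 = x'.1 + Pi.single ν 1 →
          (((ℓ : ℝ) + 1) ^ k) ^ (d + 1) * ((((ℓ : ℝ) + 1) ^ k) ^ 2 *
            |(Gfine ℓ k M k a m2 xe xe' - Gfine ℓ k M k a m2 x xe') - (Gfine ℓ k M k a m2 xe x' - Gfine ℓ k M k a m2 x x')|)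
            ≤ C * (max 1 (supNorm (x.1 - x'.1)) / ((ℓ : ℝ) + 1) ^ k)⁻¹ ^ (d + 1) *
                Real.exp (-(δ * (supNorm (x.1 - x'.1) / ((ℓ : ℝ) + 1) ^ k))) := by
  obtain ⟨δ₁, C, hδ₁, hC, hP⟩ := abs_pieceMixed_le d ℓ hℓ amin aplus m2plus ha
  set L : ℝ := (ℓ : ℝ) + 1 with hLdef
  have hL : 1 < L := one_lt_L_real hℓ
  have hL0 : 0 < L := by linarith
  set Cs : ℝ := L / (L - 1) * Real.exp (δ₁ / 2) +
      ((d + 1).factorial : ℝ) / (δ₁ / 2) ^ (d + 1) * (1 - Real.exp (-(δ₁ / 2 * (L - 1))))⁻¹ with hCs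
  have hCs0 : 0 < Cs := by
    have h1 : 0 < L / (L - 1) * Real.exp (δ₁ / 2) := by
      have : 0 < L - 1 := by linarith
      positivity
    have h2 : 0 ≤ ((d + 1).factorial : ℝ) / (δ₁ / 2) ^ (d + 1) * (1 - Real.exp (-(δ₁ / 2 * (L - 1))))⁻¹ := by
      have : 0 < 1 - Real.exp (-(δ₁ / 2 * (L - 1))) := by
        have : Real.exp (-(δ₁ / 2 * (L - 1))) < 1 := Real.exp_lt_one_iff.2 (by nlinarith)
        linarith
      positivity
    linarith
  have hq : 0 < 1 - (L ^ (d + 1))⁻¹ := by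
    have : (L ^ (d + 1))⁻¹ < 1 := inv_lt_one_of_one_lt₀ (one_lt_pow₀ hL (by omega))
    linarith
  refine ⟨L * δ₁ / 2, C * Cs + C * (1 - (L ^ (d + 1))⁻¹)⁻¹, by positivity, by positivity, ?_⟩
  intro k hk a m2 h1 h2 h3 h4 M hM μ ν x xe hxe x' xe' hxe'
  have hLk : 0 < L ^ k := pow_pos hL0 k
  have hcast : ((((ℓ + 1) ^ k : ℕ)) : ℝ) = L ^ k := cast_Lk ℓ k
  -- the per-scale bounds, summed
  have hsum : (L ^ k) ^ 2 * |(Gfine ℓ k M k a m2 xe xe' - Gfine ℓ k M k a m2 x xe')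
        - (Gfine ℓ k M k a m2 xe x' - Gfine ℓ k M k a m2 x x')|
      ≤ C * ∑ j ∈ range k, (L ^ j)⁻¹ ^ (d + 1) * Real.exp (-(δ₁ * supNorm (x.1 - x'.1) / L ^ j)) := by
    rw [Gfine_mixed_eq_sum hk, Finset.mul_sum]
    calc (L ^ k) ^ 2 * |∑ j ∈ range k, ((piece ℓ k M j a m2 xe xe' - piece ℓ k M j a m2 x xe')
            - (piece ℓ k M j a m2 xe x' - piece ℓ k M j a m2 x x'))|
        ≤ (L ^ k) ^ 2 * ∑ j ∈ range k, |(piece ℓ k M j a m2 xe xe' - piece ℓ k M j a m2 x xe')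
            - (piece ℓ k M j a m2 xe x' - piece ℓ k M j a m2 x x')| :=
          mul_le_mul_of_nonneg_left (abs_sum_le_sum_abs _ _) (by positivity)
      _ = ∑ j ∈ range k, (L ^ k) ^ 2 * |(piece ℓ k M j a m2 xe xe' - piece ℓ k M j a m2 x xe')
            - (piece ℓ k M j a m2 xe x' - piece ℓ k M j a m2 x x')| := Finset.mul_sum _ _ _
      _ ≤ ∑ j ∈ range k, C * ((L ^ j)⁻¹ ^ (d + 1) * Real.exp (-(δ₁ * supNorm (x.1 - x'.1) / L ^ j))) := by
          refine sum_le_sum fun j hj => ?_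
          have h := hP k hk j (mem_range.1 hj) a m2 h1 h2 h3 h4 M hM μ ν x xe hxe x' xe' hxe'
          rw [hcast, bj_cast, ← inv_pow, mul_assoc] at h
          exact h
  by_cases hxx : x.1 = x'.1
  · -- coincident points: the geometric series `Σ_j (L^j)^{−(d+1)}`
    have hx0 : supNorm (x.1 - x'.1) = 0 := by rw [hxx, supNorm_sub_self]
    have hm1 : max 1 (supNorm (x.1 - x'.1)) = 1 := by rw [hx0]; exact max_eq_left zero_le_one
    rw [hm1, hx0, zero_div, mul_zero, neg_zero, Real.exp_zero, mul_one, one_div, inv_inv]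
    have hS := scaleSum_zero_le hL (by omega : 1 ≤ d + 1) k
    have hsum0 : (L ^ k) ^ 2 * |(Gfine ℓ k M k a m2 xe xe' - Gfine ℓ k M k a m2 x xe')
          - (Gfine ℓ k M k a m2 xe x' - Gfine ℓ k M k a m2 x x')| ≤ C * (1 - (L ^ (d + 1))⁻¹)⁻¹ := by
      refine hsum.trans ?_
      simp only [hx0, mul_zero, zero_div, neg_zero, Real.exp_zero, mul_one]
      exact mul_le_mul_of_nonneg_left hS hC.le
    calc (L ^ k) ^ (d + 1) * ((L ^ k) ^ 2 * |(Gfine ℓ k M k a m2 xe xe' - Gfine ℓ k M k a m2 x xe')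
            - (Gfine ℓ k M k a m2 xe x' - Gfine ℓ k M k a m2 x x')|)
        ≤ (L ^ k) ^ (d + 1) * (C * (1 - (L ^ (d + 1))⁻¹)⁻¹) := mul_le_mul_of_nonneg_left hsum0 (by positivity)
      _ = C * (1 - (L ^ (d + 1))⁻¹)⁻¹ * (L ^ k) ^ (d + 1) := by ring
      _ ≤ (C * Cs + C * (1 - (L ^ (d + 1))⁻¹)⁻¹) * (L ^ k) ^ (d + 1) :=
          mul_le_mul_of_nonneg_right (le_add_of_nonneg_left (by positivity)) (by positivity)
  · have hn : max 1 (supNorm (x.1 - x'.1)) = supNorm (x.1 - x'.1) := max_one_supNorm_of_ne hxx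
    set n := supNorm (x.1 - x'.1) with hndef
    have hn1 : 1 ≤ n := by rw [← hn]; exact le_max_left _ _
    have hn0 : 0 < n := by linarith
    rw [hn]
    have hS := scaleSum_le hL hδ₁ (by omega : 1 ≤ d + 1) k hn0
    have hsum1 : (L ^ k) ^ 2 * |(Gfine ℓ k M k a m2 xe xe' - Gfine ℓ k M k a m2 x xe')
          - (Gfine ℓ k M k a m2 xe x' - Gfine ℓ k M k a m2 x x')|
        ≤ C * (Cs * n⁻¹ ^ (d + 1) * Real.exp (-(δ₁ / 2 * (n / L ^ (k - 1))))) :=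
      hsum.trans (mul_le_mul_of_nonneg_left hS hC.le)
    have hexp : Real.exp (-(δ₁ / 2 * (n / L ^ (k - 1)))) = Real.exp (-(L * δ₁ / 2 * (n / L ^ k))) := by
      rw [div_pow_pred_eq hL0 hk]; ring_nf
    have hpow : (L ^ k) ^ (d + 1) * n⁻¹ ^ (d + 1) = (n / L ^ k)⁻¹ ^ (d + 1) := by
      rw [← mul_pow, inv_div, div_eq_mul_inv]
    calc (L ^ k) ^ (d + 1) * ((L ^ k) ^ 2 * |(Gfine ℓ k M k a m2 xe xe' - Gfine ℓ k M k a m2 x xe')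
            - (Gfine ℓ k M k a m2 xe x' - Gfine ℓ k M k a m2 x x')|)
        ≤ (L ^ k) ^ (d + 1) * (C * (Cs * n⁻¹ ^ (d + 1) * Real.exp (-(δ₁ / 2 * (n / L ^ (k - 1)))))) :=
          mul_le_mul_of_nonneg_left hsum1 (by positivity)
      _ = C * Cs * ((L ^ k) ^ (d + 1) * n⁻¹ ^ (d + 1)) * Real.exp (-(L * δ₁ / 2 * (n / L ^ k))) := by rw [hexp]; ring
      _ = C * Cs * (n / L ^ k)⁻¹ ^ (d + 1) * Real.exp (-(L * δ₁ / 2 * (n / L ^ k))) := by rw [hpow]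
      _ ≤ (C * Cs + C * (1 - (L ^ (d + 1))⁻¹)⁻¹) * (n / L ^ k)⁻¹ ^ (d + 1) * Real.exp (-(L * δ₁ / 2 * (n / L ^ k))) := by
          have hP0 : 0 ≤ (n / L ^ k)⁻¹ ^ (d + 1) * Real.exp (-(L * δ₁ / 2 * (n / L ^ k))) := by positivity
          rw [mul_assoc, mul_assoc (C * Cs + _)]
          exact mul_le_mul_of_nonneg_right (le_add_of_nonneg_right (by positivity)) hP0

end Box

/-! ## §2 The infinite lattice: `G_k(0) = GkLat` at all pairs of points of `ℤ^{d+1}` -/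

section Lattice

variable {ℓ k : ℕ} {a m2 : ℝ}

/-- kernel: centring a lattice neighbour. [cite: Balaban1983Higgs3, (2.5) p.424] -/
theorem ctr_add_single_eq (n t : ℕ) (x : Fin (d + 1) → ℤ) (μ : Fin (d + 1)) :
    ctr n t (x + Pi.single μ 1) = ctr n t x + Pi.single μ 1 := by
  unfold ctr; abel

/-- kernel: a common label radius for four points. [cite: Balaban1983Higgs3, (2.5) p.424] -/
theorem exists_labRad₄ (n : ℕ) (x₁ x₂ x₃ x₄ : Fin (d + 1) → ℤ) :
    ∃ R : ℕ, LabRad n R x₁ ∧ LabRad n R x₂ ∧ LabRad n R x₃ ∧ LabRad n R x₄ := by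
  obtain ⟨R₁, h₁, h₂⟩ := exists_labRad₂ n x₁ x₂
  obtain ⟨R₂, h₃, h₄⟩ := exists_labRad₂ n x₃ x₄
  exact ⟨R₁ + R₂, h₁.mono (by omega), h₂.mono (by omega), h₃.mono (by omega), h₄.mono (by omega)⟩

/-- **[Balaban1983Higgs3] p. 437, `|G^ξ_{j″}(0; y, y′)| ≦ O(1)e^{−δ₀|y−y′|}/|y − y′|` — PROVED FOR THE PRINTED INFINITE-LATTICE
PROPAGATOR `G_k(0)` (p03's `GkLat`) AT ALL SITES** (`d + 1 ≥ 3`; counting normalisation, `n = L^k = η^{−1}`):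
`n^{d+1}·|G_k(0)(x,x′)| ≤ C·(max(1,|x−x′|_∞)/n)^{−(d−1)}·e^{−δ|x−x′|_∞/n}` for every `k ≥ 1`, window point and `x, x′ ∈ ℤ^{d+1}` — in
physical units `|G^η_k(0;x,x′)| ≤ C·(η·max(1,|x−x′|_∞))^{−(d−1)}e^{−δη|x−x′|_∞}`, the printed law for `d + 1 = 3` with the lattice
cut-off at the diagonal (the box clause `abs_Gfine_profile` on every centred cube, in the limit `tendsto_gcube`).
[cite: Balaban1983Higgs3, (3.16) p.437] -/
theorem abs_GkLat_profile (d ℓ : ℕ) (hd : 2 ≤ d) (hℓ : 1 ≤ ℓ) (amin aplus m2plus : ℝ) (ha : 0 < amin) :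
    ∃ δ C : ℝ, 0 < δ ∧ 0 < C ∧ ∀ (k : ℕ), 1 ≤ k → ∀ (a m2 : ℝ), amin ≤ a → a ≤ aplus → 0 ≤ m2 → m2 ≤ m2plus →
      ∀ (x x' : Fin (d + 1) → ℤ),
        (((ℓ : ℝ) + 1) ^ k) ^ (d + 1) * |GkLat ℓ k a m2 x x'|
          ≤ C * (max 1 (supNorm (x - x')) / ((ℓ : ℝ) + 1) ^ k)⁻¹ ^ (d - 1) *
              Real.exp (-(δ * (supNorm (x - x') / ((ℓ : ℝ) + 1) ^ k))) := by
  obtain ⟨δ, C, hδ, hC, h⟩ := abs_Gfine_profile d ℓ hd hℓ amin aplus m2plus ha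
  refine ⟨δ, C, hδ, hC, ?_⟩
  intro k hk a m2 h1 h2 h3 h4 x x'
  have hn : 1 ≤ (ℓ + 1) ^ k := Nat.one_le_pow _ _ (by omega)
  obtain ⟨R, hx, hx'⟩ := exists_labRad₂ ((ℓ + 1) ^ k) x x'
  have hB : ∀ t, R ≤ t → (((ℓ : ℝ) + 1) ^ k) ^ (d + 1) * |gcube ℓ k t a m2 x x'|
      ≤ C * (max 1 (supNorm (x - x')) / ((ℓ : ℝ) + 1) ^ k)⁻¹ ^ (d - 1) *
          Real.exp (-(δ * (supNorm (x - x') / ((ℓ : ℝ) + 1) ^ k))) := by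
    intro t ht
    have hm := ctr_mem (d := d) hn ht hx
    have hm' := ctr_mem (d := d) hn ht hx'
    have hb := h k hk a m2 h1 h2 h3 h4 (cubeM t) (cubeM_pos t) ⟨_, hm⟩ ⟨_, hm'⟩
    rw [← gcube_eq hm hm'] at hb
    simpa only [ctr_sub_ctr] using hb
  exact le_of_tendsto ((tendsto_gcube hℓ hk (ha.trans_le h1) h3 x x').abs.const_mul _) (eventually_atTop.2 ⟨R, hB⟩)

/-- **p. 437, *"the corresponding inequalities for derivatives"* for `G_k(0)` — ROW DIFFERENCE, ALL SITES**:
`n^{d+1}·n·|G_k(0)(x+e_μ,x′) − G_k(0)(x,x′)| ≤ C·(max(1,|x−x′|_∞)/n)^{−d}·e^{−δ|x−x′|_∞/n}` for every `k ≥ 1`, window point, axis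
`μ` and `x, x′ ∈ ℤ^{d+1}` (in physical units the `1/|y−y′|²` law of `∂^η_μG^η_k(0)` for `d + 1 = 3`).
[cite: Balaban1983Higgs3, (3.16) p.437] -/
theorem abs_GkLatDiff_profile (d ℓ : ℕ) (hd : 2 ≤ d) (hℓ : 1 ≤ ℓ) (amin aplus m2plus : ℝ) (ha : 0 < amin) :
    ∃ δ C : ℝ, 0 < δ ∧ 0 < C ∧ ∀ (k : ℕ), 1 ≤ k → ∀ (a m2 : ℝ), amin ≤ a → a ≤ aplus → 0 ≤ m2 → m2 ≤ m2plus →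
      ∀ (μ : Fin (d + 1)) (x x' : Fin (d + 1) → ℤ),
        (((ℓ : ℝ) + 1) ^ k) ^ (d + 1) * ((((ℓ : ℝ) + 1) ^ k) *
            |GkLat ℓ k a m2 (x + Pi.single μ 1) x' - GkLat ℓ k a m2 x x'|)
          ≤ C * (max 1 (supNorm (x - x')) / ((ℓ : ℝ) + 1) ^ k)⁻¹ ^ d *
              Real.exp (-(δ * (supNorm (x - x') / ((ℓ : ℝ) + 1) ^ k))) := by
  obtain ⟨δ, C, hδ, hC, h⟩ := abs_GfineDiff_profile d ℓ hd hℓ amin aplus m2plus ha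
  refine ⟨δ, C, hδ, hC, ?_⟩
  intro k hk a m2 h1 h2 h3 h4 μ x x'
  have hn : 1 ≤ (ℓ + 1) ^ k := Nat.one_le_pow _ _ (by omega)
  have ha0 : 0 < a := ha.trans_le h1
  obtain ⟨R, hx, hxe, hx', -⟩ := exists_labRad₄ ((ℓ + 1) ^ k) x (x + Pi.single μ 1) x' x'
  have hB : ∀ t, R ≤ t → (((ℓ : ℝ) + 1) ^ k) ^ (d + 1) * ((((ℓ : ℝ) + 1) ^ k) *
      |gcube ℓ k t a m2 (x + Pi.single μ 1) x' - gcube ℓ k t a m2 x x'|)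
      ≤ C * (max 1 (supNorm (x - x')) / ((ℓ : ℝ) + 1) ^ k)⁻¹ ^ d *
          Real.exp (-(δ * (supNorm (x - x') / ((ℓ : ℝ) + 1) ^ k))) := by
    intro t ht
    have hm := ctr_mem (d := d) hn ht hx
    have hme := ctr_mem (d := d) hn ht hxe
    have hm' := ctr_mem (d := d) hn ht hx'
    have hb := h k hk a m2 h1 h2 h3 h4 (cubeM t) (cubeM_pos t) μ ⟨_, hm⟩ ⟨_, hme⟩ (ctr_add_single_eq _ t x μ) ⟨_, hm'⟩
    rw [← gcube_eq hme hm', ← gcube_eq hm hm'] at hb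
    simpa only [ctr_sub_ctr] using hb
  exact le_of_tendsto ((((tendsto_gcube hℓ hk ha0 h3 _ x').sub (tendsto_gcube hℓ hk ha0 h3 x x')).abs.const_mul _).const_mul _)
    (eventually_atTop.2 ⟨R, hB⟩)

/-- **Column difference** (by the symmetry `GkLat_comm`): `n^{d+1}·n·|G_k(0)(x,x′+e_μ) − G_k(0)(x,x′)| ≤
C·(max(1,|x−x′|_∞)/n)^{−d}·e^{−δ|x−x′|_∞/n}` — the kernel of `G_k(0)∂^{η*}_μ`. [cite: Balaban1983Higgs3, (3.16) p.437] -/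
theorem abs_GkLatDiff'_profile (d ℓ : ℕ) (hd : 2 ≤ d) (hℓ : 1 ≤ ℓ) (amin aplus m2plus : ℝ) (ha : 0 < amin) :
    ∃ δ C : ℝ, 0 < δ ∧ 0 < C ∧ ∀ (k : ℕ), 1 ≤ k → ∀ (a m2 : ℝ), amin ≤ a → a ≤ aplus → 0 ≤ m2 → m2 ≤ m2plus →
      ∀ (μ : Fin (d + 1)) (x x' : Fin (d + 1) → ℤ),
        (((ℓ : ℝ) + 1) ^ k) ^ (d + 1) * ((((ℓ : ℝ) + 1) ^ k) *
            |GkLat ℓ k a m2 x (x' + Pi.single μ 1) - GkLat ℓ k a m2 x x'|)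
          ≤ C * (max 1 (supNorm (x - x')) / ((ℓ : ℝ) + 1) ^ k)⁻¹ ^ d *
              Real.exp (-(δ * (supNorm (x - x') / ((ℓ : ℝ) + 1) ^ k))) := by
  obtain ⟨δ, C, hδ, hC, h⟩ := abs_GkLatDiff_profile d ℓ hd hℓ amin aplus m2plus ha
  refine ⟨δ, C, hδ, hC, ?_⟩
  intro k hk a m2 h1 h2 h3 h4 μ x x'
  have hb := h k hk a m2 h1 h2 h3 h4 μ x' x
  rw [GkLat_comm (x' + Pi.single μ 1) x, GkLat_comm x' x, B4TwoRegion120.supNorm_sub_comm x' x] at hb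
  exact hb

/-- **p. 437 / (2.10) for `G_k(0)` — MIXED SECOND DIFFERENCE, ALL SITES**: `n^{d+1}·n²·|G(x+e_μ,x′+e_ν) − G(x,x′+e_ν) −
G(x+e_μ,x′) + G(x,x′)| ≤ C·(max(1,|x−x′|_∞)/n)^{−(d+1)}·e^{−δ|x−x′|_∞/n}`, `G = G_k(0)`, for every `k ≥ 1`, window point, axes and
`x, x′ ∈ ℤ^{d+1}` — in physical units the `1/|y−y′|³` law of `(∂^η_μG^η_k(0)∂^{η*}_ν)` for `d + 1 = 3`.
[cite: Balaban1983Higgs3, (2.10) p.426] -/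
theorem abs_GkLatMixed_profile (d ℓ : ℕ) (hℓ : 1 ≤ ℓ) (amin aplus m2plus : ℝ) (ha : 0 < amin) :
    ∃ δ C : ℝ, 0 < δ ∧ 0 < C ∧ ∀ (k : ℕ), 1 ≤ k → ∀ (a m2 : ℝ), amin ≤ a → a ≤ aplus → 0 ≤ m2 → m2 ≤ m2plus →
      ∀ (μ ν : Fin (d + 1)) (x x' : Fin (d + 1) → ℤ),
        (((ℓ : ℝ) + 1) ^ k) ^ (d + 1) * ((((ℓ : ℝ) + 1) ^ k) ^ 2 *
            |(GkLat ℓ k a m2 (x + Pi.single μ 1) (x' + Pi.single ν 1) - GkLat ℓ k a m2 x (x' + Pi.single ν 1))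
              - (GkLat ℓ k a m2 (x + Pi.single μ 1) x' - GkLat ℓ k a m2 x x')|)
          ≤ C * (max 1 (supNorm (x - x')) / ((ℓ : ℝ) + 1) ^ k)⁻¹ ^ (d + 1) *
              Real.exp (-(δ * (supNorm (x - x') / ((ℓ : ℝ) + 1) ^ k))) := by
  obtain ⟨δ, C, hδ, hC, h⟩ := abs_GfineMixed_profile d ℓ hℓ amin aplus m2plus ha
  refine ⟨δ, C, hδ, hC, ?_⟩
  intro k hk a m2 h1 h2 h3 h4 μ ν x x'
  have hn : 1 ≤ (ℓ + 1) ^ k := Nat.one_le_pow _ _ (by omega)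
  have ha0 : 0 < a := ha.trans_le h1
  obtain ⟨R, hx, hxe, hx', hxe'⟩ := exists_labRad₄ ((ℓ + 1) ^ k) x (x + Pi.single μ 1) x' (x' + Pi.single ν 1)
  have hB : ∀ t, R ≤ t → (((ℓ : ℝ) + 1) ^ k) ^ (d + 1) * ((((ℓ : ℝ) + 1) ^ k) ^ 2 *
      |(gcube ℓ k t a m2 (x + Pi.single μ 1) (x' + Pi.single ν 1) - gcube ℓ k t a m2 x (x' + Pi.single ν 1))
        - (gcube ℓ k t a m2 (x + Pi.single μ 1) x' - gcube ℓ k t a m2 x x')|)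
      ≤ C * (max 1 (supNorm (x - x')) / ((ℓ : ℝ) + 1) ^ k)⁻¹ ^ (d + 1) *
          Real.exp (-(δ * (supNorm (x - x') / ((ℓ : ℝ) + 1) ^ k))) := by
    intro t ht
    have hm := ctr_mem (d := d) hn ht hx
    have hme := ctr_mem (d := d) hn ht hxe
    have hm' := ctr_mem (d := d) hn ht hx'
    have hme' := ctr_mem (d := d) hn ht hxe'
    have hb := h k hk a m2 h1 h2 h3 h4 (cubeM t) (cubeM_pos t) μ ν ⟨_, hm⟩ ⟨_, hme⟩ (ctr_add_single_eq _ t x μ)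
      ⟨_, hm'⟩ ⟨_, hme'⟩ (ctr_add_single_eq _ t x' ν)
    rw [← gcube_eq hme hme', ← gcube_eq hm hme', ← gcube_eq hme hm', ← gcube_eq hm hm'] at hb
    simpa only [ctr_sub_ctr] using hb
  exact le_of_tendsto
    (((((tendsto_gcube hℓ hk ha0 h3 _ _).sub (tendsto_gcube hℓ hk ha0 h3 x _)).sub
      ((tendsto_gcube hℓ hk ha0 h3 _ x').sub (tendsto_gcube hℓ hk ha0 h3 x x'))).abs.const_mul _).const_mul _)
    (eventually_atTop.2 ⟨R, hB⟩)

end Lattice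

end

end Literature.MathematicalPhysics.QuantumFieldTheory.Balaban1983to89.B3GkZeroLatticePointwise
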